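import Summits.PneNP.PneNP.Theorems.ConvexRankGatesLinAlgGateBlindGRankLogWidth
import Summits.PneNP.PneNP.Theorems.ConvexRankGatesLinAlgGateBlindDetNormalForm

/-!
# Route ConvexRankGates, crux `LinAlgGateBlind` (stmt-PneNP-10681): the dimension of a GRANK gate is without loss its threshold — rank-threshold gates of ANY dimension

Support theorems for the crux (vocabulary of `Theorems/ConvexRankGatesLinAlgGateBlindDefs.lean`). A GRANK gate
(`IsGRankGate s`) bounds the DIMENSION `d ≤ s` of its symbolic matrix `K₀ + ∑_{vᵢ=1} Xᵢ Kᵢ` and accepts iff its generic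
rank is at least a threshold `θ`. The generic compression of the tree (`le_rank_symbolicMatrix_iff_det_compress_ne_zero`,
`…DetCompress`: `θ ≤ rank M` iff `det (P M Q) ≠ 0` for generic `θ × d`, `d × θ` matrices adjoined to the field) turns ANY
rank-threshold gate `[θ ≤ rank (K₀ + ∑_{vᵢ=1} Xᵢ Kᵢ)]`, of ARBITRARY dimension `d`, into a GRANK gate of dimension `θ`
over a larger field:

* `isGRankGate_of_threshold_le` — a rank-threshold gate with threshold `θ ≤ t` (any dimension, any field) is a `GRANK_t`
  gate; `isGRankGate_iff_threshold` — for `t ≥ 1`, `GRANK_t` IS the class of rank-threshold gates with threshold `≤ t`.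
* `sgAt_rankThreshold_logWidth`, `not_computes_clique_of_isOver_rankThreshold_logWidth` — hence the GRANK door of
  `…GRankLogWidth` holds for rank-threshold gates of UNBOUNDED dimension: for every `c`, eventually in `m`, for every `t`
  with `t² ≤ m^{7/8}/(log₂ m)^5`, the single-gate statement holds for, and no circuit with `≤ m^c` gates over `{∧₂, ∨₂}`
  plus such gates computes `CLIQUE(m, ⌈m^{1/8}⌉)`. The resource that matters is the rank threshold, not the matrix size:
  the class contains e.g. the unbounded fan-in threshold gates `Th_θ` (`Kᵢ = Eᵢᵢ`) and the "matching number `≥ θ`" gates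
  of arbitrary bipartite graphs (`K_{(a,b)} = E_{ab}`, Edmonds 1967) for `θ ≤ m^{7/16 - o(1)}`.

Sources: Edmonds 1967 §5 Thm. 1 (generic rank = largest non-vanishing minor); Lovász 1989 §1 (compression by generic
matrices); Razborov 1985, Alon–Boppana 1987 §3. No new definitions (the class is written inline). [folklore]
-/

-- `Summit.PneNP.PneNP.…` duplicates `PneNP` BY DESIGN (single-problem summit).
set_option linter.dupNamespace false

noncomputable section

namespace Summit.PneNP.PneNP.Theorems

open Finset Filter Literature.Computability.Complexity Razborov
open Summit.PneNP.PneNP.Cruxes.LinAlgGateBlind.DnfInvariantWideGatesSeeSmallCliques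

/-! ### Dimension is without loss the threshold -/

/-- **A rank-threshold gate of threshold `θ ≤ t` is a `GRANK_t` gate, whatever its dimension.** If
`g v = 1 ↔ θ ≤ rank (K₀ + ∑_{vᵢ=1} Xᵢ Kᵢ)` with `d × d` data over a field `F` (`d` arbitrary) and `θ ≤ t`, then
`IsGRankGate t g`: compress by generic `θ × d` and `d × θ` matrices (`le_rank_symbolicMatrix_iff_det_compress_ne_zero`)
to a `θ × θ` determinant gate over `Frac F[p,q]` (`isGRankGate_of_det`). [folklore] -/
theorem isGRankGate_of_threshold_le {t : ℕ} {g : GateFn} {F : Type} [Field F] {d θ : ℕ} (hθ : θ ≤ t)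
    (K₀ : Matrix (Fin d) (Fin d) F) (K : Fin g.1 → Matrix (Fin d) (Fin d) F)
    (hg : ∀ v : Fin g.1 → Bool, g.2 v = true ↔ θ ≤ (symbolicMatrix K₀ K v).rank) : IsGRankGate t g :=
  isGRankGate_of_det hθ _ _ _ fun v => (hg v).trans (le_rank_symbolicMatrix_iff_det_compress_ne_zero K₀ K θ v)

/-- **For `t ≥ 1`, `GRANK_t` is exactly the class of rank-threshold gates with threshold `≤ t` and arbitrary dimension.**
(`→`: a `GRANK_t` gate has `d ≤ t`; if `θ ≤ d` it is its own witness, and if `θ > d` it is identically false, which is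
the gate `[1 ≤ rank 0]` of dimension `0`. `←`: `isGRankGate_of_threshold_le`.) [folklore] -/
theorem isGRankGate_iff_threshold {t : ℕ} (ht : 1 ≤ t) {g : GateFn} :
    IsGRankGate t g ↔ ∃ (F : Type) (_ : Field F) (d θ : ℕ), θ ≤ t ∧ ∃ (K₀ : Matrix (Fin d) (Fin d) F)
      (K : Fin g.1 → Matrix (Fin d) (Fin d) F), ∀ v : Fin g.1 → Bool, g.2 v = true ↔ θ ≤ (symbolicMatrix K₀ K v).rank := by
  constructor
  · rintro ⟨F, _, d, θ, hd, K₀, K, hg⟩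
    by_cases hθ : θ ≤ d
    · exact ⟨F, inferInstance, d, θ, hθ.trans hd, K₀, K, hg⟩
    · refine ⟨ℚ, inferInstance, 0, 1, ht, 0, fun _ => 0, fun v => ?_⟩
      have h0 : (symbolicMatrix (0 : Matrix (Fin 0) (Fin 0) ℚ) (fun _ : Fin g.1 => 0) v).rank = 0 :=
        le_antisymm (by simpa using (symbolicMatrix (0 : Matrix (Fin 0) (Fin 0) ℚ)
          (fun _ : Fin g.1 => 0) v).rank_le_card_width) (Nat.zero_le _)
      have hlt : ¬ θ ≤ (symbolicMatrix K₀ K v).rank := fun h' =>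
        hθ (h'.trans (by simpa using (symbolicMatrix K₀ K v).rank_le_card_width))
      rw [h0]
      constructor
      · intro hv
        exact absurd ((hg v).1 hv) hlt
      · intro h
        exact absurd h (by norm_num)
  · rintro ⟨F, _, d, θ, hθ, K₀, K, hg⟩
    exact isGRankGate_of_threshold_le hθ K₀ K hg

/-- The inline class of rank-threshold gates with threshold `≤ t` is contained in `GRANK_t`. [folklore] -/
theorem rankThreshold_subset_gRank (t : ℕ) :
    {g : GateFn | ∃ (F : Type) (_ : Field F) (d θ : ℕ), θ ≤ t ∧ ∃ (K₀ : Matrix (Fin d) (Fin d) F)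
      (K : Fin g.1 → Matrix (Fin d) (Fin d) F), ∀ v : Fin g.1 → Bool,
        g.2 v = true ↔ θ ≤ (symbolicMatrix K₀ K v).rank} ⊆ {g | IsGRankGate t g} := by
  rintro g ⟨F, _, d, θ, hθ, K₀, K, hg⟩
  exact isGRankGate_of_threshold_le hθ K₀ K hg

/-! ### The GRANK door for rank-threshold gates of unbounded dimension -/

/-- **`SGAt` for rank-threshold gates of threshold `t`, `t² ≤ m^{7/8}/(log₂ m)^5`, of ANY dimension over ANY field**, at the
logarithmic width, at every level `c`, eventually in `m` (`sgAt_gRank_logWidth` through `isGRankGate_of_threshold_le`).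
[folklore] -/
theorem sgAt_rankThreshold_logWidth : ∀ c : ℕ, ∀ᶠ m : ℕ in atTop, ∀ t : ℕ,
    (t : ℝ) ^ 2 ≤ (m : ℝ) ^ (7 / 8 : ℝ) / Real.logb 2 m ^ 5 →
      SGAt m (fun g => ∃ (F : Type) (_ : Field F) (d θ : ℕ), θ ≤ t ∧ ∃ (K₀ : Matrix (Fin d) (Fin d) F)
          (K : Fin g.1 → Matrix (Fin d) (Fin d) F), ∀ v : Fin g.1 → Bool,
            g.2 v = true ↔ θ ≤ (symbolicMatrix K₀ K v).rank)
        ((2 * c + 8) * (Nat.log 2 m + 1)) (kOf m) (qOf m) (epsOf c m) := by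
  intro c
  filter_upwards [sgAt_gRank_logWidth c] with m hm t ht O hO
  exact hm t ht O (isTermGate_mono (fun g hg => rankThreshold_subset_gRank t hg) hO)

/-- **No polynomial-size monotone circuit with rank-threshold gates of threshold `≤ m^{7/16-o(1)}` — of ANY dimension,
over ANY fields, with ANY constants — computes `CLIQUE(m, ⌈m^{1/8}⌉)` (unconditional).** For every `c`, eventually in `m`,
for every `t` with `t² ≤ m^{7/8}/(log₂ m)^5` and every circuit `C` with `≤ m^c` gates over `{∧₂, ∨₂}` together with all
gates `[θ ≤ rank (K₀ + ∑_{vᵢ=1} Xᵢ Kᵢ)]`, `θ ≤ t`, `d × d` data over a field, `d` arbitrary: `¬ C.Computes CLIQUE(m, ⌈m^{1/8}⌉)`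
(`not_computes_clique_of_isOver_gRank_logWidth` through `rankThreshold_subset_gRank` and `IsOver.mono`). Instances: the
unbounded fan-in threshold gates `Th_θ` (`Kᵢ = Eᵢᵢ`), bipartite "matching number `≥ θ`" gates (`K_{(a,b)} = E_{ab}`),
"generic rank `≥ θ`" of any live matrix family. [folklore] -/
theorem not_computes_clique_of_isOver_rankThreshold_logWidth : ∀ c : ℕ, ∀ᶠ m : ℕ in atTop, ∀ t : ℕ,
    (t : ℝ) ^ 2 ≤ (m : ℝ) ^ (7 / 8 : ℝ) / Real.logb 2 m ^ 5 →
    ∀ C : Circuit (KEdge m), C.IsOver ({GateFn.and 2, GateFn.or 2} ∪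
      {g : GateFn | ∃ (F : Type) (_ : Field F) (d θ : ℕ), θ ≤ t ∧ ∃ (K₀ : Matrix (Fin d) (Fin d) F)
        (K : Fin g.1 → Matrix (Fin d) (Fin d) F), ∀ v : Fin g.1 → Bool,
          g.2 v = true ↔ θ ≤ (symbolicMatrix K₀ K v).rank}) →
      C.size ≤ m ^ c → ¬ C.Computes (cliqueFn m ⌈(m : ℝ) ^ (1 / 8 : ℝ)⌉₊) := by
  intro c
  filter_upwards [not_computes_clique_of_isOver_gRank_logWidth c] with m hm t ht C hC hsize
  exact hm t ht C (hC.mono (Set.union_subset_union_right _ (rankThreshold_subset_gRank t))) hsize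

end Summit.PneNP.PneNP.Theorems

end
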